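import Summits.ABC.IUTFork.Thm311RealInd1StripTwistJWFirst
import Summits.ABC.IUTFork.Thm311RealInd1StripTraceRigid
import Summits.ABC.IUTFork.Thm311RealInd1StripInfinite
import HarnessLib

/-!
# [IUTchIII] Thm 3.11 (i) (Ind1) at `v ∈ 𝕍^non`, EVEN local degree — statements of record from `JannsenWingbergTwistsFirst`:
# the QUADRATIC `K_v` (a shear along the trace-zero line, realised in print's (Ind1) strip part), Kondo's Thm 2.3 for EVEN `d`
# (`Ker(Tr_{K_v/ℚ_p}) = ⟨y_1, y_3, …, y_d⟩`), and the strip part is INFINITE at every `v ∣ p` odd with `[K_v : ℚ_p] ≥ 2` even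

PROOF-ONLY file (abc-iut cell, Cor. 3.12 sub-crew, seat abc-iut-c312-1 = holder of record of the typed [IUTchIII] Thm. 3.11,
gen 12; row «R14 FIRST-PLANE TWIST», part c).  TAKES NO SIDE on [IUTchIII] Cor. 3.12.

Gen 11 recorded the odd-degree half of Kondo's Thm. 2.3 (`Thm311RealInd1StripTwistKerTrace`, p497143) and the infinitude of print's
(Ind1) strip part at `[K_v : ℚ_p] ≥ 3` (`Thm311RealInd1StripInfinite`, p496033), both modulo `JannsenWingbergTwists`, whose planes
start at `(x_3, x_4)` for even `d` — so `y_1` was out of reach and the quadratic `K_v` (`d = 2`: the FIRST local degree at which the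
strip part is non-trivial, Hoshi–Nishio Rmk. 1.7) was not covered.  With the first-plane twist `x_2 ↦ x_2 x_1` (v3 fact
`JannsenWingbergTwistsFirst`, p500987; its `k_+`-action PROVED in `Thm311RealInd1StripTwistJWFirst`):
* `Real.exists_realised_basis_of_jannsenWingbergFirst` — at `v ∣ p` odd, `d = [K_v : ℚ_p] ≥ 2` even: a `ℚ_p`-basis `y` of
  `K_v^{(1/n_v)}` (`Fin 2 ⊕ Fin g × Fin 2`, `d = 2 + 2g`) with `ψ₀, ψ i, ψ' i ∈ Real.ind1StripOf v (Real.galoisLog v)` realising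
  `x ↦ x + y^*_{inl 1}(x)·y_{inl 0}` (FIRST pair) and Kondo's plane transvections;
* `Real.exists_realised_basis_trace_zero_of_jannsenWingbergFirst` — moreover `Tr(y_{inl 0}) = 0`, every plane vector trace-zero;
* **`Real.span_eq_ker_trace_of_jannsenWingbergFirst`** — KONDO'S THEOREM 2.3 FOR EVEN `d`:
  `span_{ℚ_p} {y_{inl 0}} ∪ {plane vectors} = Ker(Tr_{K_v/ℚ_p})` («`Ker(Tr_{k/ℚ_p}) = ⟨y_1, y_3, …, y_{d_k}⟩` (`d_k` even)»,
  arXiv:2512.09231 Thm. 2.3), with `Tr(y_{inl 1}) ≠ 0`;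
* **`Real.exists_shear_of_jannsenWingbergFirst_of_localDeg_eq_two`** — the QUADRATIC `K_v` (`p` odd): a basis `(y_1, y_2)` of
  `K_v^{(1/n_v)}` over `ℚ_p` and `ψ₀ ∈ Real.ind1StripOf v (Real.galoisLog v)` with `ψ₀(x) = x + y_2^*(x)·y_1`, `Tr(y_1) = 0`,
  `Tr(y_2) ≠ 0`, `Ker(Tr) = ℚ_p·y_1` — print's (Ind1) strip part contains a SHEAR ALONG THE TRACE-ZERO LINE at every quadratic `K_v`
  (Kondo p. 10; the shape of Team R's `hnLin` family at `v₇`, abc-iut-c312-14 p481415) — the position of `y_2` is NOT pinned;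
* `Real.ind1StripOf_infinite_of_jannsenWingbergFirst` (+ analytic / carrier forms) — INFINITE strip part at even `d ≥ 2`.
HONEST SCOPE: conditional theorems (binder `hJW : JannsenWingbergTwistsFirst` — Jannsen–Wingberg 1982 / NSW 7.5.14 / Hoshi–Nishio
2022, with Kondo's 2025 reading for `d ≥ 4`) about OUR typed objects at ONE place; whether the shear moves an ideal-shaped region at
`d = 2` depends on `y_2`'s position (unpinned; Team R rows R9f); no side on [IUTchIII] Cor. 3.12; NO abc claim.  [claim: Mochizuki2012, status: disputed];
[cite: Kondo2025OuterAutMLF, §2 Thm 2.3, Lemma 2.5 and proof of Thm 2.3 p.10]; [cite: HoshiNishio2022OuterAutMLF, Thm 1.5, Cor 1.6 (i),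
Lemma 2.3 (ii)]; [cite: JannsenWingberg1982, §5.1 p.96]; [cite: DupuyHilado2025, §4.7].  typed ≠ proved; a conditional theorem
discharges nothing it binds.
-/

set_option autoImplicit false

noncomputable section

open Metric Set
open scoped Pointwise

namespace Summit.ABC.IUTFork.Thm311.Real

open NumberField IsDedekindDomain Literature.NumberTheory.NumberFields Literature.IUT.LogVolume
open Literature.NumberTheory.GaloisRepresentations
open Literature.AnabelianGeometry.AbsoluteAnabelian Literature.IUT.HodgeArakelov
open Literature.IUT.HodgeArakelov.AbsTopMonoids

variable {F : Type} [Field F] [NumberField F] (v : HeightOneSpectrum (𝓞 F))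

/-! ## 1. The basis and the realised transvections, in the rescaled completion -/

/-- **The Jannsen–Wingberg basis with the plane transvections AND the first-pair transvection, REALISED in print's (Ind1) strip part —
even local degree.**  Assume `JannsenWingbergTwistsFirst`.  At a finite place `v ∣ p` of `F` with `p` odd and `d = [K_v : ℚ_p] ≥ 2`
EVEN there are `g` with `d = 2 + 2g`, a `ℚ_p`-basis `y` of `K_v^{(1/n_v)}` (abc-iut-S7's rescaled completion) indexed by
`Fin 2 ⊕ Fin g × Fin 2`, and `ψ₀, ψ i, ψ' i ∈ Real.ind1StripOf v (Real.galoisLog v)` acting as `x ↦ x + y^*_{inl 1}(x)·y_{inl 0}`,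
`x ↦ x + y^*_{(i,1)}(x)·y_{(i,0)}`, `x ↦ x − y^*_{(i,0)}(x)·y_{(i,1)}`.  (Part b's theorem read in the rescaled norm; continuity of the
transvections from finite dimension over `ℚ_p`; membership via `realises_galoisLog_of_liftActsOnUnitLogAs`.)
[claim: Mochizuki2012, status: disputed] [cite: Kondo2025OuterAutMLF, §2 Lemma 2.5 and proof of Thm 2.3 p.10]
[cite: JannsenWingberg1982, §5.1 p.96] -/
theorem exists_realised_basis_of_jannsenWingbergFirst (hJW : JannsenWingbergTwistsFirst)
    (p : ℕ) [Fact p.Prime] (hv : ((p : ℕ) : 𝓞 F) ∈ v.asIdeal) (hp2 : p ≠ 2) (h2 : 2 ≤ localDeg F v) (hev : Even (localDeg F v)) :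
    ∃ (g : ℕ) (_ : localDeg F v = 2 + 2 * g) (y : Module.Basis (Fin 2 ⊕ Fin g × Fin 2) ℚ_[p] (RescaledCompletion F p v hv))
      (ψ₀ : v.adicCompletion F ≃+ v.adicCompletion F) (ψ ψ' : Fin g → (v.adicCompletion F ≃+ v.adicCompletion F)),
      ψ₀ ∈ ind1StripOf v (galoisLog v) ∧ (∀ i, ψ i ∈ ind1StripOf v (galoisLog v)) ∧ (∀ i, ψ' i ∈ ind1StripOf v (galoisLog v)) ∧
      (∀ x : RescaledCompletion F p v hv,
        RescaledCompletion.of F p v hv (ψ₀ ((RescaledCompletion.of F p v hv).symm x)) = x + y.coord (Sum.inl 1) x • y (Sum.inl 0)) ∧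
      (∀ i (x : RescaledCompletion F p v hv),
        RescaledCompletion.of F p v hv (ψ i ((RescaledCompletion.of F p v hv).symm x)) =
          x + y.coord (Sum.inr (i, 1)) x • y (Sum.inr (i, 0))) ∧
      (∀ i (x : RescaledCompletion F p v hv),
        RescaledCompletion.of F p v hv (ψ' i ((RescaledCompletion.of F p v hv).symm x)) =
          x - y.coord (Sum.inr (i, 0)) x • y (Sum.inr (i, 1))) := by
  -- `p` IS the residue characteristic of `K_v`
  obtain rfl : p = (closureAt v).residueChar := eq_residueChar_closureAt_of_natCast_mem v hv
  have hpk : ValuativeRel.valuation (v.adicCompletion F) (closureAt v).residueChar < 1 :=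
    LocalField.valuation_adicCompletion_natCast_lt_one v (closureAt v).residueChar hv
  haveI : CharZero (closureAt v).k := (closureAt v).instChar
  letI iQ : Algebra ℚ_[(closureAt v).residueChar] (closureAt v).k :=
    LocalField.padicAlgebra (closureAt v).k (closureAt v).residueChar hpk
  have hlocal : localDeg F v = Module.finrank ℚ_[(closureAt v).residueChar] (closureAt v).k := by
    exact RescaledCompletion.localDeg_eq_finrank F (closureAt v).residueChar v hv
  have hfin : 2 ≤ Module.finrank ℚ_[(closureAt v).residueChar] (closureAt v).k := by rw [← hlocal]; exact h2
  have hev' : Even (Module.finrank ℚ_[(closureAt v).residueChar] (closureAt v).k) := by rw [← hlocal]; exact hev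
  -- part b: ONE basis, all planes and the first pair realised through THE equivariant lift
  obtain ⟨g, hg, y, hplanes, ⟨φ₀, hφ₀⟩⟩ := dehnTwistsFirst_closureAt_of_jannsenWingbergFirst v hJW hpk hp2 hfin hev'
  have h1 := fun i => (hplanes i).1
  have h1' := fun i => (hplanes i).2
  choose φ hφ using h1
  choose φ' hφ' using h1'
  have hcard : localDeg F v = 2 + 2 * g := by rw [hlocal, ← hg]
  -- the module topology of `K_v` over `ℚ_p`: linear maps are continuous
  haveI : ContinuousSMul ℚ_[(closureAt v).residueChar] (closureAt v).k :=
    continuousSMul_of_algebraMap ℚ_[(closureAt v).residueChar] _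
      (by exact LocalField.continuous_algebraMap_adicCompletionPadicAlgebra v (closureAt v).residueChar hv)
  haveI : FiniteDimensional ℚ_[(closureAt v).residueChar] (closureAt v).k :=
    Module.finite_of_finrank_pos (by omega)
  -- a transvection `x ↦ x + c(x)•a` with `c a = 0` as a linear automorphism
  have hcoord : ∀ s t : Fin 2 ⊕ Fin g × Fin 2, y.coord s (y t) = if t = s then 1 else 0 := by
    intro s t
    rw [Module.Basis.coord_apply, Module.Basis.repr_self, Finsupp.single_apply]
  let tv : ∀ (s t : Fin 2 ⊕ Fin g × Fin 2), s ≠ t → ((closureAt v).k ≃ₗ[ℚ_[(closureAt v).residueChar]] (closureAt v).k) :=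
    fun s t hst =>
    LinearEquiv.ofLinear
      (LinearMap.id + (y.coord t).smulRight (y s))
      (LinearMap.id - (y.coord t).smulRight (y s))
      (by
        apply LinearMap.ext; intro x
        simp [hst])
      (by
        apply LinearMap.ext; intro x
        simp [hst])
  have htv : ∀ s t hst x, tv s t hst x = x + y.coord t x • y s := fun s t hst x => rfl
  have htv_sub : ∀ s t hst x, (tv s t hst).symm x = x - y.coord t x • y s := fun s t hst x => rfl
  -- membership in print's (Ind1) strip part over the Galois logarithm
  have hne01 : (Sum.inl 0 : Fin 2 ⊕ Fin g × Fin 2) ≠ Sum.inl 1 := by simp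
  have hneab : ∀ i : Fin g, (Sum.inr (i, 0) : Fin 2 ⊕ Fin g × Fin 2) ≠ Sum.inr (i, 1) := fun i => by simp
  have hneba : ∀ i : Fin g, (Sum.inr (i, 1) : Fin 2 ⊕ Fin g × Fin 2) ≠ Sum.inr (i, 0) := fun i => by simp
  have hψ₀ : (tv _ _ hne01).toAddEquiv ∈ ind1StripOf v (galoisLog v) :=
    ⟨by exact (tv _ _ hne01).toLinearMap.continuous_of_finiteDimensional,
      by exact (tv _ _ hne01).symm.toLinearMap.continuous_of_finiteDimensional, φ₀,
      realises_galoisLog_of_liftActsOnUnitLogAs v hpk φ₀ _ hφ₀ (tv _ _ hne01).toAddEquiv (htv _ _ hne01)⟩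
  have hψ : ∀ i, (tv _ _ (hneab i)).toAddEquiv ∈ ind1StripOf v (galoisLog v) := fun i =>
    ⟨by exact (tv _ _ (hneab i)).toLinearMap.continuous_of_finiteDimensional,
      by exact (tv _ _ (hneab i)).symm.toLinearMap.continuous_of_finiteDimensional, φ i,
      realises_galoisLog_of_liftActsOnUnitLogAs v hpk (φ i) _ (hφ i) (tv _ _ (hneab i)).toAddEquiv (htv _ _ (hneab i))⟩
  have hψ' : ∀ i, (tv _ _ (hneba i)).symm.toAddEquiv ∈ ind1StripOf v (galoisLog v) := fun i =>
    ⟨by exact (tv _ _ (hneba i)).symm.toLinearMap.continuous_of_finiteDimensional,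
      by exact (tv _ _ (hneba i)).toLinearMap.continuous_of_finiteDimensional, φ' i,
      realises_galoisLog_of_liftActsOnUnitLogAs v hpk (φ' i) _ (hφ' i) (tv _ _ (hneba i)).symm.toAddEquiv
        (htv_sub _ _ (hneba i))⟩
  -- transport to the rescaled norm (`of` is the identity of `K_v`, `ℚ_p`-linear)
  let e := RescaledCompletion.of F (closureAt v).residueChar v hv
  let eL : (closureAt v).k ≃ₗ[ℚ_[(closureAt v).residueChar]] RescaledCompletion F (closureAt v).residueChar v hv :=
    { e.toAddEquiv with
      map_smul' := fun c x => by
        change e (c • x) = c • e x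
        rw [Algebra.smul_def, Algebra.smul_def, map_mul]
        rfl }
  have heL : ∀ x, eL x = e x := fun x => rfl
  have heLs : ∀ x, eL.symm x = e.symm x := fun x => rfl
  let yR : Module.Basis (Fin 2 ⊕ Fin g × Fin 2) ℚ_[(closureAt v).residueChar]
      (RescaledCompletion F (closureAt v).residueChar v hv) := y.map eL
  have hyR : ∀ s, yR s = eL (y s) := fun s => Module.Basis.map_apply y eL s
  have hyRc : ∀ s x, yR.coord s x = y.coord s (eL.symm x) := by
    intro s x
    change (y.map eL).repr x s = y.repr (eL.symm x) s
    rw [Module.Basis.map_repr, LinearEquiv.trans_apply]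
  refine ⟨g, hcard, yR, (tv _ _ hne01).toAddEquiv, fun i => (tv _ _ (hneab i)).toAddEquiv,
    fun i => (tv _ _ (hneba i)).symm.toAddEquiv, hψ₀, hψ, hψ', ?_, ?_, ?_⟩
  · intro x
    change e (tv _ _ hne01 (e.symm x)) = x + yR.coord (Sum.inl 1) x • yR (Sum.inl 0)
    rw [htv _ _ hne01, map_add, RingEquiv.apply_symm_apply, hyRc, hyR, ← heL, ← heLs, map_smul]
  · intro i x
    change e (tv _ _ (hneab i) (e.symm x)) = x + yR.coord (Sum.inr (i, 1)) x • yR (Sum.inr (i, 0))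
    rw [htv _ _ (hneab i), map_add, RingEquiv.apply_symm_apply, hyRc, hyR, ← heL, ← heLs, map_smul]
  · intro i x
    change e ((tv _ _ (hneba i)).symm (e.symm x)) = x - yR.coord (Sum.inr (i, 0)) x • yR (Sum.inr (i, 1))
    rw [htv_sub _ _ (hneba i), map_sub, RingEquiv.apply_symm_apply, hyRc, hyR, ← heL, ← heLs, map_smul]

/-! ## 2. Trace rigidity: the first vector and the plane vectors are trace-zero -/
/-- **`Tr(y_1) = 0` and the plane vectors are trace-zero** — the data of `exists_realised_basis_of_jannsenWingbergFirst` with, IN ADDITION,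
`Tr_{K_v/ℚ_p}(y_{inl 0}) = 0` and `Tr(y_{(i,ε)}) = 0` for every plane vector: by trace rigidity of print's (Ind1) strip part (gen 11
`trace_apply_eq_of_mem_ind1StripOf`, Hoshi–Nishio Lem. 2.3 (ii)) `Tr(y_2 + y_1) = Tr(ψ₀ y_2) = Tr(y_2)` (Kondo p. 10: «`α_2 y_1 =
φ_+(α_1y_1 + α_2y_2) − (α_1y_1 + α_2y_2) ∈ Ker(Tr)`»). [claim: Mochizuki2012, status: disputed]
[cite: Kondo2025OuterAutMLF, §2 proof of Thm 2.3 p.10] [cite: HoshiNishio2022OuterAutMLF, Lemma 2.3 (ii) p.7] -/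
theorem exists_realised_basis_trace_zero_of_jannsenWingbergFirst (hJW : JannsenWingbergTwistsFirst)
    (p : ℕ) [Fact p.Prime] (hv : ((p : ℕ) : 𝓞 F) ∈ v.asIdeal) (hp2 : p ≠ 2) (h2 : 2 ≤ localDeg F v) (hev : Even (localDeg F v)) :
    ∃ (g : ℕ) (_ : localDeg F v = 2 + 2 * g) (y : Module.Basis (Fin 2 ⊕ Fin g × Fin 2) ℚ_[p] (RescaledCompletion F p v hv))
      (ψ₀ : v.adicCompletion F ≃+ v.adicCompletion F) (ψ ψ' : Fin g → (v.adicCompletion F ≃+ v.adicCompletion F)),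
      ψ₀ ∈ ind1StripOf v (galoisLog v) ∧ (∀ i, ψ i ∈ ind1StripOf v (galoisLog v)) ∧ (∀ i, ψ' i ∈ ind1StripOf v (galoisLog v)) ∧
      (∀ x : RescaledCompletion F p v hv,
        RescaledCompletion.of F p v hv (ψ₀ ((RescaledCompletion.of F p v hv).symm x)) = x + y.coord (Sum.inl 1) x • y (Sum.inl 0)) ∧
      (∀ i (x : RescaledCompletion F p v hv),
        RescaledCompletion.of F p v hv (ψ i ((RescaledCompletion.of F p v hv).symm x)) =
          x + y.coord (Sum.inr (i, 1)) x • y (Sum.inr (i, 0))) ∧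
      (∀ i (x : RescaledCompletion F p v hv),
        RescaledCompletion.of F p v hv (ψ' i ((RescaledCompletion.of F p v hv).symm x)) =
          x - y.coord (Sum.inr (i, 0)) x • y (Sum.inr (i, 1))) ∧
      Algebra.trace ℚ_[p] (RescaledCompletion F p v hv) (y (Sum.inl 0)) = 0 ∧
      (∀ iε : Fin g × Fin 2, Algebra.trace ℚ_[p] (RescaledCompletion F p v hv) (y (Sum.inr iε)) = 0) := by
  obtain rfl : p = (closureAt v).residueChar := eq_residueChar_closureAt_of_natCast_mem v hv
  obtain ⟨g, hcard, y, ψ₀, ψ, ψ', hψ₀, hψ, hψ', hT₀, hT, hT'⟩ :=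
    exists_realised_basis_of_jannsenWingbergFirst v hJW (closureAt v).residueChar hv hp2 h2 hev
  have hcoord : ∀ s t : Fin 2 ⊕ Fin g × Fin 2, y.coord s (y t) = if t = s then 1 else 0 := by
    intro s t
    rw [Module.Basis.coord_apply, Module.Basis.repr_self, Finsupp.single_apply]
  refine ⟨g, hcard, y, ψ₀, ψ, ψ', hψ₀, hψ, hψ', hT₀, hT, hT', ?_, ?_⟩
  · -- `Tr(y_2 + y_1) = Tr(y_2)`
    have h := trace_apply_eq_of_mem_ind1StripOf v hψ₀ ((RescaledCompletion.of F (closureAt v).residueChar v hv).symm (y (Sum.inl 1)))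
    rw [hT₀, RingEquiv.apply_symm_apply, hcoord, if_pos rfl, one_smul, map_add, add_eq_left] at h
    exact h
  · rintro ⟨i, ε⟩
    fin_cases ε
    · -- `Tr(y_b + y_a) = Tr(y_b)`
      have h := trace_apply_eq_of_mem_ind1StripOf v (hψ i)
        ((RescaledCompletion.of F (closureAt v).residueChar v hv).symm (y (Sum.inr (i, 1))))
      rw [hT i, RingEquiv.apply_symm_apply, hcoord, if_pos rfl, one_smul, map_add, add_eq_left] at h
      exact h
    · -- `Tr(y_a − y_b) = Tr(y_a)`
      have h := trace_apply_eq_of_mem_ind1StripOf v (hψ' i)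
        ((RescaledCompletion.of F (closureAt v).residueChar v hv).symm (y (Sum.inr (i, 0))))
      rw [hT' i, RingEquiv.apply_symm_apply, hcoord, if_pos rfl, one_smul, map_sub, sub_eq_self] at h
      exact h

/-! ## 3. Kondo's Theorem 2.3 for EVEN local degree -/
/-- **KONDO'S THEOREM 2.3 FOR `[K_v : ℚ_p]` EVEN, from the group-level fact with the first-plane twist.**  Assume
`JannsenWingbergTwistsFirst`.  At `v ∣ p` odd with `d = [K_v : ℚ_p] ≥ 2` EVEN, for the realised Jannsen–Wingberg basis `y` of
`exists_realised_basis_trace_zero_of_jannsenWingbergFirst` (`Fin 2 ⊕ Fin g × Fin 2`, `d = 2 + 2g`):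
`span_{ℚ_p} ({y_{inl 0}} ∪ {y_{(i,ε)}}) = Ker(Tr_{K_v/ℚ_p})` — «`Ker(Tr_{k/ℚ_p}) = ⟨y_1, y_3, …, y_{d_k}⟩_{ℚ_p}` (`d_k` even)» — and
`Tr(y_{inl 1}) ≠ 0`: the `1 + 2g = d − 1` vectors are trace-zero (§2) and independent (sub-family of a basis), while `dim Ker(Tr) = d − 1`
(`Tr 1 = d ≠ 0`). [claim: Mochizuki2012, status: disputed] [cite: Kondo2025OuterAutMLF, §2 Thm 2.3]
[cite: HoshiNishio2022OuterAutMLF, Lemma 2.3 (ii) p.7] -/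
theorem span_eq_ker_trace_of_jannsenWingbergFirst (hJW : JannsenWingbergTwistsFirst)
    (p : ℕ) [Fact p.Prime] (hv : ((p : ℕ) : 𝓞 F) ∈ v.asIdeal) (hp2 : p ≠ 2) (h2 : 2 ≤ localDeg F v) (hev : Even (localDeg F v)) :
    ∃ (g : ℕ) (_ : localDeg F v = 2 + 2 * g) (y : Module.Basis (Fin 2 ⊕ Fin g × Fin 2) ℚ_[p] (RescaledCompletion F p v hv))
      (ψ₀ : v.adicCompletion F ≃+ v.adicCompletion F),
      ψ₀ ∈ ind1StripOf v (galoisLog v) ∧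
      (∀ x : RescaledCompletion F p v hv,
        RescaledCompletion.of F p v hv (ψ₀ ((RescaledCompletion.of F p v hv).symm x)) = x + y.coord (Sum.inl 1) x • y (Sum.inl 0)) ∧
      Submodule.span ℚ_[p] (insert (y (Sum.inl 0)) (Set.range fun iε : Fin g × Fin 2 => y (Sum.inr iε))) =
        LinearMap.ker (Algebra.trace ℚ_[p] (RescaledCompletion F p v hv)) ∧
      Algebra.trace ℚ_[p] (RescaledCompletion F p v hv) (y (Sum.inl 1)) ≠ 0 := by
  obtain ⟨g, hcard, y, ψ₀, ψ, ψ', hψ₀, -, -, hT₀, -, -, ht0, htp⟩ :=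
    exists_realised_basis_trace_zero_of_jannsenWingbergFirst v hJW p hv hp2 h2 hev
  haveI : FiniteDimensional ℚ_[p] (RescaledCompletion F p v hv) := FiniteDimensional.of_locallyCompactSpace ℚ_[p]
  set Tr := Algebra.trace ℚ_[p] (RescaledCompletion F p v hv) with hTr
  have hfin : Module.finrank ℚ_[p] (RescaledCompletion F p v hv) = localDeg F v :=
    (RescaledCompletion.localDeg_eq_finrank F p v hv).symm
  -- the sub-family `{y_1} ∪ planes`, indexed by `Option (Fin g × Fin 2)`
  let ι : Option (Fin g × Fin 2) → Fin 2 ⊕ Fin g × Fin 2 := fun o => o.elim (Sum.inl 0) Sum.inr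
  have hι : Function.Injective ι := by
    rintro (_ | a) (_ | b) h
    · rfl
    · exact absurd h (by simp [ι])
    · exact absurd h (by simp [ι])
    · simp only [ι, Option.elim_some, Sum.inr.injEq] at h; rw [h]
  have hrange : Set.range (y ∘ ι) = insert (y (Sum.inl 0)) (Set.range fun iε : Fin g × Fin 2 => y (Sum.inr iε)) := by
    ext z
    simp only [Set.mem_range, Function.comp_apply, Set.mem_insert_iff]
    constructor
    · rintro ⟨_ | a, rfl⟩
      · exact Or.inl rfl
      · exact Or.inr ⟨a, rfl⟩
    · rintro (rfl | ⟨a, rfl⟩)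
      · exact ⟨none, rfl⟩
      · exact ⟨some a, rfl⟩
  -- `⊆`: trace-zero
  have hle : Submodule.span ℚ_[p] (Set.range (y ∘ ι)) ≤ LinearMap.ker Tr := by
    rw [Submodule.span_le]
    rintro _ ⟨_ | a, rfl⟩
    · exact (LinearMap.mem_ker).mpr ht0
    · exact (LinearMap.mem_ker).mpr (htp a)
  -- the span has dimension `1 + 2g`
  have hli : LinearIndependent ℚ_[p] (y ∘ ι) := y.linearIndependent.comp ι hι
  have hspan : Module.finrank ℚ_[p] (Submodule.span ℚ_[p] (Set.range (y ∘ ι))) = 1 + 2 * g := by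
    rw [finrank_span_eq_card hli, Fintype.card_option, Fintype.card_prod, Fintype.card_fin, Fintype.card_fin]
    ring
  -- `Tr` is onto `ℚ_p` (`Tr 1 = d ≠ 0`), so `dim Ker(Tr) = d − 1`
  have hTr1 : Tr 1 ≠ 0 := by
    rw [hTr, ← map_one (algebraMap ℚ_[p] (RescaledCompletion F p v hv)), Algebra.trace_algebraMap, hfin, nsmul_eq_mul, mul_one]
    exact_mod_cast (show localDeg F v ≠ 0 by omega)
  have hrangeTr : LinearMap.range Tr = ⊤ := by
    rw [eq_top_iff]
    intro t _
    refine ⟨(t / Tr 1) • (1 : RescaledCompletion F p v hv), ?_⟩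
    rw [map_smul, smul_eq_mul, div_mul_cancel₀ t hTr1]
  have hker : Module.finrank ℚ_[p] (LinearMap.ker Tr) = 1 + 2 * g := by
    have h := LinearMap.finrank_range_add_finrank_ker Tr
    rw [hrangeTr, finrank_top, Module.finrank_self, hfin, hcard] at h
    omega
  have heq : Submodule.span ℚ_[p] (Set.range (y ∘ ι)) = LinearMap.ker Tr :=
    Submodule.eq_of_le_of_finrank_eq hle (by rw [hspan, hker])
  refine ⟨g, hcard, y, ψ₀, hψ₀, hT₀, by rw [← hrange]; exact heq, fun h1 => hTr1 ?_⟩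
  -- if also `Tr(y_2) = 0`, every basis vector is trace-zero, so `Tr = 0`
  have hall : ∀ s, Tr (y s) = 0 := by
    rintro (t | a)
    · fin_cases t
      · exact ht0
      · exact h1
    · exact htp a
  have hzero : Tr = 0 := y.ext fun s => by rw [hall s, LinearMap.zero_apply]
  rw [hzero, LinearMap.zero_apply]

/-! ## 4. The quadratic `K_v` -/

/-- **THE QUADRATIC CASE — a SHEAR ALONG THE TRACE-ZERO LINE in print's (Ind1) strip part.**  Assume `JannsenWingbergTwistsFirst`.  At
every finite place `v ∣ p` of a number field with `p` odd and `[K_v : ℚ_p] = 2` there are a `ℚ_p`-basis `(y_0, y_1)` of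
`K_v^{(1/n_v)}` and `ψ₀ ∈ Real.ind1StripOf v (Real.galoisLog v)` with `ψ₀(x) = x + y_1^*(x)·y_0`, `Tr(y_0) = 0`, `Tr(y_1) ≠ 0`, and
`Ker(Tr_{K_v/ℚ_p}) = ℚ_p·y_0` — Jannsen–Wingberg's `ψ` (§5.1, `n = 2`) = Hoshi–Nishio's `*α` (`d(G) = 2`, Thm. 1.5) = Kondo's `φ`
(«`φ_+(α_1y_1 + α_2y_2) = (α_1 + α_2)y_1 + α_2y_2`», «`y_1 ∈ Ker(Tr)`», p. 10) read on the real log-shell carrier.  The position of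
`y_1` against a given `𝒪_v`-lattice (hence whether `ψ₀` moves an ideal-shaped region) is NOT pinned by print.
[claim: Mochizuki2012, status: disputed] [cite: Kondo2025OuterAutMLF, §2 proof of Thm 2.3 (case d_k = 2) p.10]
[cite: HoshiNishio2022OuterAutMLF, §1 p.5 l.22–31 (definition of *α, Thm 1.5)] [cite: JannsenWingberg1982, §5.1 p.96] -/
theorem exists_shear_of_jannsenWingbergFirst_of_localDeg_eq_two (hJW : JannsenWingbergTwistsFirst)
    (p : ℕ) [Fact p.Prime] (hv : ((p : ℕ) : 𝓞 F) ∈ v.asIdeal) (hp2 : p ≠ 2) (hd : localDeg F v = 2) :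
    ∃ (y : Module.Basis (Fin 2) ℚ_[p] (RescaledCompletion F p v hv)) (ψ₀ : v.adicCompletion F ≃+ v.adicCompletion F),
      ψ₀ ∈ ind1StripOf v (galoisLog v) ∧
      (∀ x : RescaledCompletion F p v hv,
        RescaledCompletion.of F p v hv (ψ₀ ((RescaledCompletion.of F p v hv).symm x)) = x + y.coord 1 x • y 0) ∧
      Algebra.trace ℚ_[p] (RescaledCompletion F p v hv) (y 0) = 0 ∧
      Algebra.trace ℚ_[p] (RescaledCompletion F p v hv) (y 1) ≠ 0 ∧
      LinearMap.ker (Algebra.trace ℚ_[p] (RescaledCompletion F p v hv)) = Submodule.span ℚ_[p] {y 0} := by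
  obtain ⟨g, hcard, y, ψ₀, hψ₀, hT₀, hspan, ht1⟩ :=
    span_eq_ker_trace_of_jannsenWingbergFirst v hJW p hv hp2 (by omega) ⟨1, by omega⟩
  have hg : g = 0 := by omega
  subst hg
  -- reindex `Fin 2 ⊕ Fin 0 × Fin 2 ≃ Fin 2`
  let ε : Fin 2 ⊕ Fin 0 × Fin 2 ≃ Fin 2 := Equiv.sumEmpty (Fin 2) (Fin 0 × Fin 2)
  let y2 : Module.Basis (Fin 2) ℚ_[p] (RescaledCompletion F p v hv) := y.reindex ε
  have hy2 : ∀ t : Fin 2, y2 t = y (Sum.inl t) := fun t => by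
    rw [Module.Basis.reindex_apply]; rfl
  have hy2c : ∀ (t : Fin 2) x, y2.coord t x = y.coord (Sum.inl t) x := fun t x => by
    rw [Module.Basis.coord_apply, Module.Basis.coord_apply, Module.Basis.repr_reindex_apply]; rfl
  have ht0 : Algebra.trace ℚ_[p] (RescaledCompletion F p v hv) (y (Sum.inl 0)) = 0 := by
    have h : y (Sum.inl 0) ∈ LinearMap.ker (Algebra.trace ℚ_[p] (RescaledCompletion F p v hv)) := by
      rw [← hspan]; exact Submodule.subset_span (Set.mem_insert _ _)
    exact (LinearMap.mem_ker).mp h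
  refine ⟨y2, ψ₀, hψ₀, fun x => ?_, by rw [hy2]; exact ht0, by rw [hy2]; exact ht1, ?_⟩
  · rw [hT₀, hy2c, hy2]
  · rw [← hspan, hy2]
    congr 1
    ext z
    simp only [Set.mem_insert_iff, Set.mem_range, Set.mem_singleton_iff, IsEmpty.exists_iff, or_false]

/-! ## 5. Infinitely many strip automorphisms at even local degree ≥ 2 -/

/-- **PRINT'S (Ind1) STRIP PART AT `v` IS INFINITE at every `v ∣ p` odd with `[K_v : ℚ_p] ≥ 2` EVEN — in particular at every QUADRATIC
`K_v`** — modulo `JannsenWingbergTwistsFirst`: the iterates `n • ψ₀` of the first-pair shear satisfy `(n • ψ₀)(y_{inl 1}) = y_{inl 1} +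
n·y_{inl 0}`, `y_{inl 0} ≠ 0` (Hoshi–Nishio Thm. 1.5 / Cor. 1.6 (i): «the image of the natural homomorphism from the outer automorphism
group of `G` to the automorphism group of `k_+(G)` is infinite», for `d(G) > 1`).  Gen 11's `ind1StripOf_infinite_of_jannsenWingberg`
needed `[K_v : ℚ_p] ≥ 3`.  Dupuy–Hilado's strip slot is `{1}`. [claim: Mochizuki2012, status: disputed]
[cite: HoshiNishio2022OuterAutMLF, Thm 1.5 and Cor 1.6 (i) p.5] [cite: DupuyHilado2025, §4.7] -/
theorem ind1StripOf_infinite_of_jannsenWingbergFirst (hJW : JannsenWingbergTwistsFirst)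
    (p : ℕ) [Fact p.Prime] (hv : ((p : ℕ) : 𝓞 F) ∈ v.asIdeal) (hp2 : p ≠ 2) (h2 : 2 ≤ localDeg F v) (hev : Even (localDeg F v)) :
    (ind1StripOf v (galoisLog v)).Infinite := by
  obtain ⟨g, -, y, ψ₀, -, -, hψ₀, -, -, hT₀, -, -⟩ := exists_realised_basis_of_jannsenWingbergFirst v hJW p hv hp2 h2 hev
  set e := RescaledCompletion.of F p v hv with he
  have hcoord : ∀ s t : Fin 2 ⊕ Fin g × Fin 2, y.coord s (y t) = if t = s then 1 else 0 := by
    intro s t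
    rw [Module.Basis.coord_apply, Module.Basis.repr_self, Finsupp.single_apply]
  have hy0 : y (Sum.inl 0) ≠ 0 := y.ne_zero _
  set χ : AddAut (v.adicCompletion F) := ψ₀ with hχ
  -- the iterates of `χ` act as `x ↦ x + n • (c x • y_1)`
  have hpow : ∀ (n : ℕ) (x : RescaledCompletion F p v hv),
      e ((n • χ) (e.symm x)) = x + (n : ℚ_[p]) • (y.coord (Sum.inl 1) x • y (Sum.inl 0)) := by
    intro n
    induction n with
    | zero => intro x; rw [zero_nsmul, Nat.cast_zero, zero_smul, add_zero]; exact e.apply_symm_apply x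
    | succ n ih =>
      intro x
      rw [succ_nsmul, AddAut.add_apply, ← e.symm_apply_apply (χ (e.symm x)), hT₀ x, ih, map_add, map_smul, hcoord,
        if_neg (by simp), smul_zero, add_zero, Nat.cast_succ, add_smul, one_smul, add_assoc,
        add_comm (y.coord (Sum.inl 1) x • y (Sum.inl 0))]
  have hinj : Function.Injective fun n : ℕ => n • χ := by
    intro n m hnm
    have h := congrArg (fun ξ : AddAut (v.adicCompletion F) => e (ξ (e.symm (y (Sum.inl 1))))) hnm
    simp only at h
    rw [hpow, hpow, hcoord, if_pos rfl, one_smul, add_right_inj] at h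
    exact_mod_cast smul_left_injective ℚ_[p] hy0 h
  exact Set.infinite_of_injective_forall_mem hinj fun n => nsmul_mem_ind1StripOf v (galoisLog v) hψ₀ n

/-- The same over abc-iut-c312-5's ANALYTIC logarithm. [claim: Mochizuki2012, status: disputed] [cite: HoshiNishio2022OuterAutMLF, Cor 1.6 (i) p.5] -/
theorem ind1StripOf_analyticLogv_infinite_of_jannsenWingbergFirst (hJW : JannsenWingbergTwistsFirst)
    (p : ℕ) [Fact p.Prime] (hv : ((p : ℕ) : 𝓞 F) ∈ v.asIdeal) (hp2 : p ≠ 2) (h2 : 2 ≤ localDeg F v) (hev : Even (localDeg F v)) :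
    (ind1StripOf v (analyticLogv F v)).Infinite := by
  rw [← galoisLog_eq_analyticLogv]
  exact ind1StripOf_infinite_of_jannsenWingbergFirst v hJW p hv hp2 h2 hev

/-- **Carrier form**: the (Ind1) strip slot `Real.ind1Strip (analyticLogv F) v` of the print signature is INFINITE at every `v ∣ p` odd
with `[K_v : ℚ_p] ≥ 2` even (so at every quadratic `K_v`), modulo `JannsenWingbergTwistsFirst`; Dupuy–Hilado's `Real.stripAutDH (inr v)`
is `{1}`. [claim: Mochizuki2012, status: disputed] [cite: HoshiNishio2022OuterAutMLF, Cor 1.6 (i) p.5] [cite: DupuyHilado2025, §4.7] -/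
theorem ind1Strip_infinite_of_jannsenWingbergFirst (hJW : JannsenWingbergTwistsFirst)
    (p : ℕ) [Fact p.Prime] (hv : ((p : ℕ) : 𝓞 F) ∈ v.asIdeal) (hp2 : p ≠ 2) (h2 : 2 ≤ localDeg F v) (hev : Even (localDeg F v)) :
    (ind1Strip (analyticLogv F) v).Infinite := by
  intro hfin
  apply ind1StripOf_analyticLogv_infinite_of_jannsenWingbergFirst v hJW p hv hp2 h2 hev
  have hsub : ind1StripOf v (analyticLogv F v) ⊆
      (fun ψ : Carrier (.inr v : Place F) ≃ₗ[ℚ] Carrier (.inr v : Place F) =>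
        (ψ.toAddEquiv : v.adicCompletion F ≃+ v.adicCompletion F)) '' ind1Strip (analyticLogv F) v := by
    intro χ hχ
    let χ' : Carrier (.inr v : Place F) ≃+ Carrier (.inr v : Place F) := χ
    let Lχ : Carrier (.inr v : Place F) ≃ₗ[ℚ] Carrier (.inr v : Place F) :=
      χ'.toLinearEquiv fun c x => map_rat_smul χ' c x
    have hq : (Lχ.toAddEquiv : v.adicCompletion F ≃+ v.adicCompletion F) = χ := by
      ext x; rfl
    refine ⟨Lχ, ?_, hq⟩
    change (Lχ.toAddEquiv : v.adicCompletion F ≃+ v.adicCompletion F) ∈ ind1StripOf v (analyticLogv F v)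
    rw [hq]
    exact hχ
  exact (hfin.image _).subset hsub

end Summit.ABC.IUTFork.Thm311.Real

end
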